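import Literature.Barriers.PneNP.TSPExtensionComplexityMatchingsOps
import Mathlib.GroupTheory.Perm.Basic
import Mathlib.Data.Fintype.Perm
import Mathlib.Data.Fintype.Sum
import Mathlib.Data.Fintype.Prod
import Mathlib.Tactic.Ring
import Mathlib.Tactic.Linarith
import HarnessLib

/-!
# Rothvoß's partitions, I: slots, blocks, cuts and matchings respecting a partition

Support file for the discharge of `Literature.Barriers.PneNP.Rothvoss2017_tsp` (Rothvoß 2017,
§3). Rothvoß fixes `|V| = n = 3m(k-3) + 2k` and averages over uniformly random PARTITIONS
`T = (A₁ ∪̇ … ∪̇ A_m, C, D, B₁ ∪̇ … ∪̇ B_m)` of `V` with `|A_i| = k-3`, `|C| = |D| = k`,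
`|B_i| = 2(k-3)` (§3.1, PDF p. 8), together with a random `3`-matching `H ⊆ C × D`.

Formalisation choice (ours): write `q = k - 3` (even) and take as vertex set the type
`Slot m q` of ROLE SLOTS itself — `a i x` (`i ≤ m`; the blocks `A_i` for `i < m`, and for
`i = m` the `q` vertices of `C` off the `3`-matching), `c t`, `d t` (`t < 3`; the endpoints of
`H` in `C` and in `D`), `dr x` (the rest of `D`), `b i side x` (block `B_i`, in two halves) — so
that a partition-with-`3`-matching is simply a PERMUTATION `π` of `Slot m q` (`π v` = the slot
of vertex `v`; uniform `π` induces the uniform distribution on pairs `(T, H)`), and the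
re-randomisations in Rothvoß's Lemmas 9, 14, 15 become left multiplication by explicit slot
permutations. This file: the blocks of `T(π)` as pull-backs of slot sets (`pull`), the edge set
`E(T)` (`SameRole`), the families `𝒰_all(T)`, `ℳ_all(T)` (§3.1), the `3`-matching `H(π)`, the
`k`-matching `F(π) ⊇ H(π)` (both read off the pairing of the `C`-slots with the `D`-slots
indexed by `X = Fin 3 ⊕ Fin q`), the conditioned families `𝒰ex`, `ℳex` of §3.2, and the KEY
FACT behind "the intersection `δ(U) ∩ M` can only contain edges in `E(C ∪ D)`" (PDF p. 8): for
compatible `(U, M)` one has `δ(U) ∩ M = H` exactly (`cut_eq_H`).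

Sources: [Rothvoss2017] §3.1–3.2 (PDF pp. 8–9).
-/

namespace Literature.Barriers.PneNP

open Finset

/-- Role slots = vertices. `a i x`: block `A_i` (`i < m`) or `C` minus the matching (`i = m`);
`c t` / `d t`: the `C`- / `D`-endpoint of the `t`-th edge of `H`; `dr x`: rest of `D`;
`b i side x`: block `B_i` (two halves). [cite: Rothvoss2017, §3.1 (PDF p. 8)] -/
inductive Slot (m q : ℕ) : Type
  /-- `A`-type slots (`i = m` is the part of `C` off the `3`-matching) -/
  | a (i : Fin (m + 1)) (x : Fin q)
  /-- the `C`-endpoints of `H` -/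
  | c (t : Fin 3)
  /-- the `D`-endpoints of `H` -/
  | d (t : Fin 3)
  /-- the rest of `D` -/
  | dr (x : Fin q)
  /-- block `B_i`, in two halves -/
  | b (i : Fin m) (side : Bool) (x : Fin q)
  deriving DecidableEq

namespace Slot

variable {m q : ℕ}

/-- `Slot m q` as a sum of products. [folklore] -/
def equivSum : Slot m q ≃ (Fin (m + 1) × Fin q) ⊕ (Fin 3 ⊕ Fin 3) ⊕ (Fin q ⊕ (Fin m × Bool × Fin q)) where
  toFun
    | a i x => Sum.inl (i, x)
    | c t => Sum.inr (Sum.inl (Sum.inl t))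
    | d t => Sum.inr (Sum.inl (Sum.inr t))
    | dr x => Sum.inr (Sum.inr (Sum.inl x))
    | b i s x => Sum.inr (Sum.inr (Sum.inr (i, s, x)))
  invFun
    | Sum.inl (i, x) => a i x
    | Sum.inr (Sum.inl (Sum.inl t)) => c t
    | Sum.inr (Sum.inl (Sum.inr t)) => d t
    | Sum.inr (Sum.inr (Sum.inl x)) => dr x
    | Sum.inr (Sum.inr (Sum.inr (i, s, x))) => b i s x
  left_inv v := by cases v <;> rfl
  right_inv w := by rcases w with ⟨i, x⟩ | (t | t) | (x | ⟨i, s, x⟩) <;> rfl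

/-- Finiteness. [folklore] -/
instance : Fintype (Slot m q) := Fintype.ofEquiv _ equivSum.symm

/-- `|Slot m q| = 3 m q + 2 q + 6 = 3m(k-3) + 2k` for `k = q + 3`. [cite: Rothvoss2017, §2 (PDF p. 6)] -/
theorem card (m q : ℕ) : Fintype.card (Slot m q) = 3 * m * q + 2 * q + 6 := by
  rw [Fintype.card_congr (equivSum (m := m) (q := q))]
  simp only [Fintype.card_sum, Fintype.card_prod, Fintype.card_fin, Fintype.card_bool]
  ring

/-- The blocks of the partition `T`: `A i` (`i < m`), `CD` (for `C ∪ D`, inside which all edges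
are allowed), `B i`. [cite: Rothvoss2017, §3.1 (PDF p. 8)] -/
inductive Role (m : ℕ) : Type
  /-- block `A_i` -/
  | A (i : Fin m)
  /-- the block `C ∪ D` -/
  | CD
  /-- block `B_i` -/
  | B (i : Fin m)
  deriving DecidableEq

/-- The block of a slot. [cite: Rothvoss2017, §3.1 (PDF p. 8)] -/
def role : Slot m q → Role m
  | a i _ => if h : (i : ℕ) < m then Role.A ⟨i, h⟩ else Role.CD
  | c _ => Role.CD
  | d _ => Role.CD
  | dr _ => Role.CD
  | b i _ _ => Role.B i

/-- Slots of `A ∪ C` (where cuts live). [folklore] -/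
def isAC : Slot m q → Bool
  | a _ _ => true
  | c _ => true
  | _ => false

/-- The `C`-slots, indexed by `X = Fin 3 ⊕ Fin q`. [folklore] -/
def Cslot : Fin 3 ⊕ Fin q → Slot m q
  | Sum.inl t => c t
  | Sum.inr x => a (Fin.last m) x

/-- The `D`-slots, indexed by `X = Fin 3 ⊕ Fin q` (so that `F` pairs `Cslot ξ` with `Dslot ξ`).
[folklore] -/
def Dslot : Fin 3 ⊕ Fin q → Slot m q
  | Sum.inl t => d t
  | Sum.inr x => dr x

/-- Auxiliary (`Cslot_injective`). [folklore] -/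
theorem Cslot_injective : Function.Injective (Cslot : Fin 3 ⊕ Fin q → Slot m q) := by
  rintro (t | x) (t' | x') h <;> simp_all [Cslot]

/-- Auxiliary (`Dslot_injective`). [folklore] -/
theorem Dslot_injective : Function.Injective (Dslot : Fin 3 ⊕ Fin q → Slot m q) := by
  rintro (t | x) (t' | x') h <;> simp_all [Dslot]

/-- Auxiliary (`Cslot_ne_Dslot`). [folklore] -/
theorem Cslot_ne_Dslot (ξ ξ' : Fin 3 ⊕ Fin q) : (Cslot ξ : Slot m q) ≠ Dslot ξ' := by
  rcases ξ with t | x <;> rcases ξ' with t' | x' <;> simp [Cslot, Dslot]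

/-! ### Slot sets -/

/-- The slots of block `A_i` / of `C` off the matching (`i = m`). [folklore] -/
def aSlots (i : Fin (m + 1)) : Finset (Slot m q) := univ.image (a i)
/-- The `C`-endpoints of `H`. [folklore] -/
def cSlots : Finset (Slot m q) := univ.image c
/-- The `D`-endpoints of `H`. [folklore] -/
def dSlots : Finset (Slot m q) := univ.image d
/-- All of `C`. [folklore] -/
def CSlots : Finset (Slot m q) := univ.image Cslot
/-- All of `D`. [folklore] -/
def DSlots : Finset (Slot m q) := univ.image Dslot

/-- Auxiliary (`mem_aSlots`). [folklore] -/
@[simp] theorem mem_aSlots {i : Fin (m + 1)} {s : Slot m q} : s ∈ aSlots i ↔ ∃ x, s = a i x := by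
  simp only [aSlots, mem_image, mem_univ, true_and]
  exact ⟨fun ⟨x, hx⟩ => ⟨x, hx.symm⟩, fun ⟨x, hx⟩ => ⟨x, hx.symm⟩⟩
/-- Auxiliary (`mem_cSlots`). [folklore] -/
@[simp] theorem mem_cSlots {s : Slot m q} : s ∈ cSlots ↔ ∃ t, s = c t := by
  simp only [cSlots, mem_image, mem_univ, true_and]
  exact ⟨fun ⟨x, hx⟩ => ⟨x, hx.symm⟩, fun ⟨x, hx⟩ => ⟨x, hx.symm⟩⟩
/-- Auxiliary (`mem_dSlots`). [folklore] -/
@[simp] theorem mem_dSlots {s : Slot m q} : s ∈ dSlots ↔ ∃ t, s = d t := by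
  simp only [dSlots, mem_image, mem_univ, true_and]
  exact ⟨fun ⟨x, hx⟩ => ⟨x, hx.symm⟩, fun ⟨x, hx⟩ => ⟨x, hx.symm⟩⟩

/-- Auxiliary (`mem_CSlots`). [folklore] -/
theorem mem_CSlots {s : Slot m q} : s ∈ CSlots ↔ (∃ t, s = c t) ∨ ∃ x, s = a (Fin.last m) x := by
  simp only [CSlots, mem_image, mem_univ, true_and]
  constructor
  · rintro ⟨t | x, rfl⟩
    · exact Or.inl ⟨t, rfl⟩
    · exact Or.inr ⟨x, rfl⟩
  · rintro (⟨t, rfl⟩ | ⟨x, rfl⟩)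
    · exact ⟨Sum.inl t, rfl⟩
    · exact ⟨Sum.inr x, rfl⟩

/-- Auxiliary (`mem_DSlots`). [folklore] -/
theorem mem_DSlots {s : Slot m q} : s ∈ DSlots ↔ (∃ t, s = d t) ∨ ∃ x, s = dr x := by
  simp only [DSlots, mem_image, mem_univ, true_and]
  constructor
  · rintro ⟨t | x, rfl⟩
    · exact Or.inl ⟨t, rfl⟩
    · exact Or.inr ⟨x, rfl⟩
  · rintro (⟨t, rfl⟩ | ⟨x, rfl⟩)
    · exact ⟨Sum.inl t, rfl⟩
    · exact ⟨Sum.inr x, rfl⟩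

/-- Auxiliary (`CSlots_eq`). [folklore] -/
theorem CSlots_eq : (CSlots : Finset (Slot m q)) = cSlots ∪ aSlots (Fin.last m) := by
  ext s
  rw [mem_CSlots, mem_union, mem_cSlots, mem_aSlots]

/-- Auxiliary (`card_aSlots`). [folklore] -/
theorem card_aSlots (i : Fin (m + 1)) : (aSlots i : Finset (Slot m q)).card = q := by
  rw [aSlots, card_image_of_injective _ (fun x y h => by simpa using h)]
  simp
/-- Auxiliary (`card_cSlots`). [folklore] -/
theorem card_cSlots : (cSlots : Finset (Slot m q)).card = 3 := by
  rw [cSlots, card_image_of_injective _ (fun x y h => by simpa using h)]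
  simp
/-- Auxiliary (`card_dSlots`). [folklore] -/
theorem card_dSlots : (dSlots : Finset (Slot m q)).card = 3 := by
  rw [dSlots, card_image_of_injective _ (fun x y h => by simpa using h)]
  simp

end Slot

open Slot

variable {m q : ℕ}

/-! ### Blocks of the partition `T(π)` -/

/-- The vertices whose slot lies in `S`: the pull-back of a slot set along `π`. [folklore] -/
def pull (π : Equiv.Perm (Slot m q)) (S : Finset (Slot m q)) : Finset (Slot m q) :=
  S.map π.symm.toEmbedding

/-- Auxiliary (`mem_pull`). [folklore] -/
@[simp] theorem mem_pull {π : Equiv.Perm (Slot m q)} {S : Finset (Slot m q)} {v : Slot m q} :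
    v ∈ pull π S ↔ π v ∈ S := by
  simp only [pull, mem_map, Equiv.coe_toEmbedding]
  constructor
  · rintro ⟨s, hs, rfl⟩
    simpa using hs
  · intro h
    exact ⟨π v, h, by simp⟩

/-- Auxiliary (`card_pull`). [folklore] -/
theorem card_pull (π : Equiv.Perm (Slot m q)) (S : Finset (Slot m q)) : (pull π S).card = S.card :=
  card_map _

/-- Auxiliary (`pull_union`). [folklore] -/
theorem pull_union (π : Equiv.Perm (Slot m q)) (S S' : Finset (Slot m q)) :
    pull π (S ∪ S') = pull π S ∪ pull π S' := by
  ext v; simp [mem_pull]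

/-- Block `A_i` of `T(π)` (`i < m`). [cite: Rothvoss2017, §3.1 (PDF p. 8)] -/
def Ablk (π : Equiv.Perm (Slot m q)) (i : Fin m) : Finset (Slot m q) := pull π (aSlots (Fin.castSucc i))
/-- `C` of `T(π)`. [cite: Rothvoss2017, §3.1 (PDF p. 8)] -/
def Cset (π : Equiv.Perm (Slot m q)) : Finset (Slot m q) := pull π CSlots
/-- `D` of `T(π)`. [cite: Rothvoss2017, §3.1 (PDF p. 8)] -/
def Dset (π : Equiv.Perm (Slot m q)) : Finset (Slot m q) := pull π DSlots
/-- `V(H) ∩ C`: the `C`-endpoints of `H(π)`. [cite: Rothvoss2017, §3.2 (PDF p. 8)] -/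
def cset (π : Equiv.Perm (Slot m q)) : Finset (Slot m q) := pull π cSlots
/-- `V(H) ∩ D`. [cite: Rothvoss2017, §3.2 (PDF p. 8)] -/
def dset (π : Equiv.Perm (Slot m q)) : Finset (Slot m q) := pull π dSlots

/-- Two slots in the same block of `T` (`A_i`, `C ∪ D`, or `B_i`). [folklore] -/
def SameRole (π : Equiv.Perm (Slot m q)) : Sym2 (Slot m q) → Prop :=
  Sym2.lift ⟨fun u v => role (π u) = role (π v), fun _ _ => propext eq_comm⟩

/-- Auxiliary (`sameRole_mk`). [folklore] -/
@[simp] theorem sameRole_mk (π : Equiv.Perm (Slot m q)) (u v : Slot m q) :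
    SameRole π s(u, v) ↔ role (π u) = role (π v) := Iff.rfl

/-- `SameRole` is decidable. [folklore] -/
instance instDecidablePredSameRole (π : Equiv.Perm (Slot m q)) : DecidablePred (SameRole π) :=
  fun e => Quot.recOnSubsingleton (motive := fun e => Decidable (SameRole π e)) e
    fun p => inferInstanceAs (Decidable (role (π p.1) = role (π p.2)))

/-- **`ℳ_all(T)`**: the perfect matchings of `V` using only edges inside blocks ("`M ⊆ E(T)`").
[cite: Rothvoss2017, §3.1 (PDF p. 8)] -/
def MallP (π : Equiv.Perm (Slot m q)) : Finset (Finset (Sym2 (Slot m q))) :=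
  (perfectMatchings univ).filter fun M => ∀ e ∈ M, SameRole π e

variable (q) in
/-- The cut size `t = (μ+1) q + 3 = (m+1)(k-3)/2 + 3` for `m = 2μ + 1`. [cite: Rothvoss2017, §2 (PDF p. 6)] -/
def tCut (μ : ℕ) : ℕ := (μ + 1) * q + 3

/-- **`𝒰_all(T)`**: the `t`-vertex cuts inside `A ∪ C` that contain each `A_i` entirely or not
at all. [cite: Rothvoss2017, §3.1 (PDF p. 8)] -/
def UallP (μ : ℕ) (π : Equiv.Perm (Slot m q)) : Finset (Finset (Slot m q)) :=
  univ.filter fun U => U.card = tCut q μ ∧ (∀ v ∈ U, isAC (π v) = true) ∧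
    ∀ i : Fin m, Ablk π i ⊆ U ∨ Disjoint (Ablk π i) U

/-- The `ξ`-th edge of the `C–D` pairing under `π`. [folklore] -/
def fEdge (π : Equiv.Perm (Slot m q)) (ξ : Fin 3 ⊕ Fin q) : Sym2 (Slot m q) :=
  s(π.symm (Cslot ξ), π.symm (Dslot ξ))

/-- **The `3`-matching `H(π) ⊆ C × D`.** [cite: Rothvoss2017, §3.2 (PDF p. 8)] -/
def Hm (π : Equiv.Perm (Slot m q)) : Finset (Sym2 (Slot m q)) :=
  univ.image fun t : Fin 3 => fEdge π (Sum.inl t)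

/-- **The `k`-matching `F(π) ⊇ H(π)`**, a perfect matching between `C` and `D`.
[cite: Rothvoss2017, §3.2 (PDF p. 9)] -/
def Fm (π : Equiv.Perm (Slot m q)) : Finset (Sym2 (Slot m q)) := univ.image (fEdge π)

/-- `𝒰ex(T,H)`: cuts of `𝒰_all(T)` with `U ∩ C = V(H) ∩ C`. [cite: Rothvoss2017, §3.2 (PDF p. 8)] -/
def Uex3 (μ : ℕ) (π : Equiv.Perm (Slot m q)) : Finset (Finset (Slot m q)) :=
  (UallP μ π).filter fun U => U ∩ Cset π = cset π

/-- Cuts of `𝒰_all(T)` with `U ∩ C = C` (the `k`-side). [cite: Rothvoss2017, §3.2 (PDF p. 8)] -/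
def UexC (μ : ℕ) (π : Equiv.Perm (Slot m q)) : Finset (Finset (Slot m q)) :=
  (UallP μ π).filter fun U => Cset π ⊆ U

/-- `ℳex(T,H)`: matchings of `ℳ_all(T)` with `M ∩ δ(C) = H`. [cite: Rothvoss2017, §3.2 (PDF p. 8)] -/
def Mex3 (π : Equiv.Perm (Slot m q)) : Finset (Finset (Sym2 (Slot m q))) :=
  (MallP π).filter fun M => (M.filter fun e => cutCount (Cset π) e = 1) = Hm π

/-- Matchings of `ℳ_all(T)` containing `F` (the `k`-side; then `M ∩ δ(C) = F`).
[cite: Rothvoss2017, §3.2 (PDF p. 9)] -/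
def MexF (π : Equiv.Perm (Slot m q)) : Finset (Finset (Sym2 (Slot m q))) :=
  (MallP π).filter fun M => Fm π ⊆ M

/-! ### Elementary slot facts -/

/-- Auxiliary (`role_a_last`). [folklore] -/
theorem role_a_last (x : Fin q) : role (a (Fin.last m) x : Slot m q) = Role.CD := by
  simp [role]

/-- Auxiliary (`role_a_castSucc`). [folklore] -/
theorem role_a_castSucc (i : Fin m) (x : Fin q) :
    role (a (Fin.castSucc i) x : Slot m q) = Role.A i := by
  simp [role]

/-- Auxiliary (`role_Cslot`). [folklore] -/
theorem role_Cslot (ξ : Fin 3 ⊕ Fin q) : role (Cslot ξ : Slot m q) = Role.CD := by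
  rcases ξ with t | x
  · rfl
  · exact role_a_last x

/-- Auxiliary (`role_Dslot`). [folklore] -/
theorem role_Dslot (ξ : Fin 3 ⊕ Fin q) : role (Dslot ξ : Slot m q) = Role.CD := by
  rcases ξ with t | x <;> rfl

/-- The role of an `a`-slot: `CD` exactly for the last index. [folklore] -/
theorem role_a_eq_CD_iff (i : Fin (m + 1)) (x : Fin q) : role (a i x : Slot m q) = Role.CD ↔ i = Fin.last m := by
  simp only [role]
  constructor
  · intro h
    split_ifs at h with hi
    exact Fin.ext (by rw [Fin.val_last]; have := i.2; omega)
  · rintro rfl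
    simp

/-- The role of an `a`-slot: `A j` exactly for `i = castSucc j`. [folklore] -/
theorem role_a_eq_A_iff (i : Fin (m + 1)) (x : Fin q) (j : Fin m) :
    role (a i x : Slot m q) = Role.A j ↔ i = Fin.castSucc j := by
  simp only [role]
  constructor
  · intro h
    split_ifs at h with hi
    simp only [Role.A.injEq] at h
    exact Fin.ext (by rw [Fin.val_castSucc, ← h])
  · rintro rfl
    simp

/-- A slot has role `CD` iff it is a `C`- or `D`-slot. [folklore] -/
theorem role_eq_CD_iff (s : Slot m q) : role s = Role.CD ↔ s ∈ CSlots ∨ s ∈ DSlots := by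
  rw [mem_CSlots, mem_DSlots]
  rcases s with ⟨i, x⟩ | t | t | x | ⟨i, sd, x⟩
  · rw [role_a_eq_CD_iff]
    constructor
    · rintro rfl
      exact Or.inl (Or.inr ⟨x, rfl⟩)
    · rintro ((⟨t, ht⟩ | ⟨y, hy⟩) | (⟨t, ht⟩ | ⟨y, hy⟩))
      · exact absurd ht (by simp)
      · simp only [Slot.a.injEq] at hy
        exact hy.1
      · exact absurd ht (by simp)
      · exact absurd hy (by simp)
  · simp [role]
  · simp [role]
  · simp [role]
  · simp [role]

/-- Slots of role `A i` are the `a (castSucc i)`-slots. [folklore] -/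
theorem role_eq_A_iff (s : Slot m q) (i : Fin m) : role s = Role.A i ↔ ∃ x, s = a (Fin.castSucc i) x := by
  rcases s with ⟨j, x⟩ | t | t | x | ⟨j, sd, x⟩
  · rw [role_a_eq_A_iff]
    constructor
    · rintro rfl
      exact ⟨x, rfl⟩
    · rintro ⟨y, hy⟩
      simp only [Slot.a.injEq] at hy
      exact hy.1
  · simp [role]
  · simp [role]
  · simp [role]
  · simp [role]

/-- Slots of role `B i` are the `b i`-slots. [folklore] -/
theorem role_eq_B_iff (s : Slot m q) (i : Fin m) : role s = Role.B i ↔ ∃ sd x, s = b i sd x := by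
  rcases s with ⟨j, x⟩ | t | t | x | ⟨j, sd, x⟩
  · simp only [role, reduceCtorEq, exists_false, iff_false]
    split_ifs <;> simp
  · simp [role]
  · simp [role]
  · simp [role]
  · simp only [role, Role.B.injEq, Slot.b.injEq]
    constructor
    · rintro rfl
      exact ⟨sd, x, rfl, rfl, rfl⟩
    · rintro ⟨sd', x', h, -, -⟩
      exact h

/-- `C`-slots are in `A ∪ C`; `D`- and `B`-slots are not. [folklore] -/
theorem isAC_of_mem_CSlots {s : Slot m q} (h : s ∈ CSlots) : isAC s = true := by
  rcases mem_CSlots.1 h with ⟨t, rfl⟩ | ⟨x, rfl⟩ <;> rfl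

/-- Auxiliary (`isAC_of_mem_DSlots`). [folklore] -/
theorem isAC_of_mem_DSlots {s : Slot m q} (h : s ∈ DSlots) : isAC s = false := by
  rcases mem_DSlots.1 h with ⟨t, rfl⟩ | ⟨x, rfl⟩ <;> rfl

/-- Auxiliary (`isAC_b`). [folklore] -/
theorem isAC_b (i : Fin m) (sd : Bool) (x : Fin q) : isAC (b i sd x : Slot m q) = false := rfl

/-- Auxiliary (`disjoint_CSlots_DSlots`). [folklore] -/
theorem disjoint_CSlots_DSlots : Disjoint (CSlots : Finset (Slot m q)) DSlots := by
  rw [disjoint_left]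
  intro s hC hD
  have h1 := isAC_of_mem_CSlots hC
  rw [isAC_of_mem_DSlots hD] at h1
  exact Bool.false_ne_true h1

/-- Auxiliary (`cSlots_subset_CSlots`). [folklore] -/
theorem cSlots_subset_CSlots : (cSlots : Finset (Slot m q)) ⊆ CSlots := by
  rw [CSlots_eq]; exact subset_union_left

/-- Auxiliary (`dSlots_subset_DSlots`). [folklore] -/
theorem dSlots_subset_DSlots : (dSlots : Finset (Slot m q)) ⊆ DSlots := by
  intro s hs
  obtain ⟨t, rfl⟩ := mem_dSlots.1 hs
  exact mem_DSlots.2 (Or.inl ⟨t, rfl⟩)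

/-- Auxiliary (`cset_subset_Cset`). [folklore] -/
theorem cset_subset_Cset (π : Equiv.Perm (Slot m q)) : cset π ⊆ Cset π := fun v hv => by
  simp only [cset, Cset, mem_pull] at hv ⊢; exact cSlots_subset_CSlots hv

/-- Auxiliary (`dset_subset_Dset`). [folklore] -/
theorem dset_subset_Dset (π : Equiv.Perm (Slot m q)) : dset π ⊆ Dset π := fun v hv => by
  simp only [dset, Dset, mem_pull] at hv ⊢; exact dSlots_subset_DSlots hv

/-- Auxiliary (`disjoint_Cset_Dset`). [folklore] -/
theorem disjoint_Cset_Dset (π : Equiv.Perm (Slot m q)) : Disjoint (Cset π) (Dset π) := by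
  rw [disjoint_left]
  intro v hC hD
  simp only [Cset, Dset, mem_pull] at hC hD
  exact disjoint_left.1 disjoint_CSlots_DSlots hC hD

/-! ### Pairings are perfect matchings -/

/-- A pairing of two disjoint injective families is a perfect matching of their ranges.
[folklore] -/
theorem isPMOn_pairing {κ V : Type*} [Fintype κ] [DecidableEq V] (f g : κ → V)
    (hf : Function.Injective f) (hg : Function.Injective g) (hfg : ∀ x y, f x ≠ g y) :
    IsPMOn (univ.image f ∪ univ.image g) (univ.image fun x => s(f x, g x)) := by
  refine ⟨?_, ?_, ?_⟩
  · intro e he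
    obtain ⟨x, -, rfl⟩ := mem_image.1 he
    rw [mk_mem_sym2_iff]
    exact ⟨mem_union_left _ (mem_image_of_mem f (mem_univ x)),
      mem_union_right _ (mem_image_of_mem g (mem_univ x))⟩
  · intro e he
    obtain ⟨x, -, rfl⟩ := mem_image.1 he
    rw [Sym2.mk_isDiag_iff]
    exact hfg x x
  · intro v hv
    rw [card_eq_one]
    rcases mem_union.1 hv with hv | hv
    · obtain ⟨x, -, rfl⟩ := mem_image.1 hv
      refine ⟨s(f x, g x), ?_⟩
      ext e
      simp only [mem_filter, mem_image, mem_univ, true_and, mem_singleton]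
      constructor
      · rintro ⟨⟨y, rfl⟩, hmem⟩
        rcases Sym2.mem_iff.1 hmem with h | h
        · rw [hf h.symm]
        · exact absurd h (hfg x y)
      · rintro rfl
        exact ⟨⟨x, rfl⟩, Sym2.mem_mk_left _ _⟩
    · obtain ⟨x, -, rfl⟩ := mem_image.1 hv
      refine ⟨s(f x, g x), ?_⟩
      ext e
      simp only [mem_filter, mem_image, mem_univ, true_and, mem_singleton]
      constructor
      · rintro ⟨⟨y, rfl⟩, hmem⟩
        rcases Sym2.mem_iff.1 hmem with h | h
        · exact absurd h.symm (hfg y x)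
        · rw [hg h.symm]
      · rintro rfl
        exact ⟨⟨x, rfl⟩, Sym2.mem_mk_right _ _⟩

/-- Auxiliary (`cset_eq_image`). [folklore] -/
theorem cset_eq_image (π : Equiv.Perm (Slot m q)) : cset π = univ.image fun t => π.symm (c t) := by
  ext v
  simp only [cset, mem_pull, mem_cSlots, mem_image, mem_univ, true_and]
  constructor
  · rintro ⟨t, ht⟩
    exact ⟨t, by rw [← ht]; simp⟩
  · rintro ⟨t, rfl⟩
    exact ⟨t, by simp⟩

/-- Auxiliary (`dset_eq_image`). [folklore] -/
theorem dset_eq_image (π : Equiv.Perm (Slot m q)) : dset π = univ.image fun t => π.symm (d t) := by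
  ext v
  simp only [dset, mem_pull, mem_dSlots, mem_image, mem_univ, true_and]
  constructor
  · rintro ⟨t, ht⟩
    exact ⟨t, by rw [← ht]; simp⟩
  · rintro ⟨t, rfl⟩
    exact ⟨t, by simp⟩

/-- Auxiliary (`Cset_eq_image`). [folklore] -/
theorem Cset_eq_image (π : Equiv.Perm (Slot m q)) : Cset π = univ.image fun ξ => π.symm (Cslot ξ) := by
  ext v
  simp only [Cset, CSlots, mem_pull, mem_image, mem_univ, true_and]
  constructor
  · rintro ⟨ξ, h⟩
    exact ⟨ξ, by rw [h]; simp⟩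
  · rintro ⟨ξ, rfl⟩
    exact ⟨ξ, by simp⟩

/-- Auxiliary (`Dset_eq_image`). [folklore] -/
theorem Dset_eq_image (π : Equiv.Perm (Slot m q)) : Dset π = univ.image fun ξ => π.symm (Dslot ξ) := by
  ext v
  simp only [Dset, DSlots, mem_pull, mem_image, mem_univ, true_and]
  constructor
  · rintro ⟨ξ, h⟩
    exact ⟨ξ, by rw [h]; simp⟩
  · rintro ⟨ξ, rfl⟩
    exact ⟨ξ, by simp⟩

/-- `H(π)` is a perfect matching of `V(H) = c ∪ d`. [folklore] -/
theorem isPMOn_Hm (π : Equiv.Perm (Slot m q)) : IsPMOn (cset π ∪ dset π) (Hm π) := by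
  rw [cset_eq_image, dset_eq_image]
  exact isPMOn_pairing _ _ (fun x y h => by simpa using π.symm.injective h)
    (fun x y h => by simpa using π.symm.injective h)
    (fun x y h => by have := π.symm.injective h; simp at this)

/-- `F(π)` is a perfect matching of `C ∪ D`. [folklore] -/
theorem isPMOn_Fm (π : Equiv.Perm (Slot m q)) : IsPMOn (Cset π ∪ Dset π) (Fm π) := by
  rw [Cset_eq_image, Dset_eq_image]
  exact isPMOn_pairing _ _ (fun x y h => Cslot_injective (π.symm.injective h))
    (fun x y h => Dslot_injective (π.symm.injective h))
    (fun x y h => Cslot_ne_Dslot x y (π.symm.injective h))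

/-- Auxiliary (`mem_Hm_iff`). [folklore] -/
theorem mem_Hm_iff {π : Equiv.Perm (Slot m q)} {e : Sym2 (Slot m q)} :
    e ∈ Hm π ↔ ∃ t : Fin 3, e = s(π.symm (c t), π.symm (d t)) := by
  simp [Hm, fEdge, Cslot, Dslot, eq_comm]

/-- Auxiliary (`mem_Fm_iff`). [folklore] -/
theorem mem_Fm_iff {π : Equiv.Perm (Slot m q)} {e : Sym2 (Slot m q)} :
    e ∈ Fm π ↔ ∃ ξ, e = fEdge π ξ := by
  simp [Fm, eq_comm]

/-- Auxiliary (`Hm_subset_Fm`). [folklore] -/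
theorem Hm_subset_Fm (π : Equiv.Perm (Slot m q)) : Hm π ⊆ Fm π := by
  intro e he
  obtain ⟨t, -, rfl⟩ := mem_image.1 he
  exact mem_image_of_mem _ (mem_univ _)

/-- Auxiliary (`fEdge_injective`). [folklore] -/
theorem fEdge_injective (π : Equiv.Perm (Slot m q)) : Function.Injective (fEdge π) := by
  intro ξ ξ' h
  rw [fEdge, fEdge, Sym2.eq_iff] at h
  rcases h with ⟨h1, -⟩ | ⟨h1, -⟩
  · exact Cslot_injective (π.symm.injective h1)
  · exact absurd (π.symm.injective h1) (Cslot_ne_Dslot ξ ξ')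

/-- Auxiliary (`card_Hm`). [folklore] -/
theorem card_Hm (π : Equiv.Perm (Slot m q)) : (Hm π).card = 3 := by
  rw [Hm, card_image_of_injective]
  · simp
  · intro t t' h
    simpa using fEdge_injective π h

/-- Auxiliary (`card_Fm`). [folklore] -/
theorem card_Fm (π : Equiv.Perm (Slot m q)) : (Fm π).card = q + 3 := by
  rw [Fm, card_image_of_injective _ (fEdge_injective π)]
  simp [add_comm]

/-- Edges of `F` (hence of `H`) have exactly one endpoint in `C`. [folklore] -/
theorem cutCount_Cset_fEdge (π : Equiv.Perm (Slot m q)) (ξ : Fin 3 ⊕ Fin q) :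
    cutCount (Cset π) (fEdge π ξ) = 1 := by
  rw [fEdge, cutCount_mk]
  have h1 : π.symm (Cslot ξ) ∈ Cset π := by simp [Cset, mem_pull, CSlots]
  have h2 : π.symm (Dslot ξ) ∉ Cset π := by
    simp only [Cset, mem_pull, Equiv.apply_symm_apply]
    intro h
    exact disjoint_left.1 disjoint_CSlots_DSlots h (by simp [DSlots])
  simp [h1, h2]

/-- Auxiliary (`cutCount_Cset_of_mem_Hm`). [folklore] -/
theorem cutCount_Cset_of_mem_Hm {π : Equiv.Perm (Slot m q)} {e : Sym2 (Slot m q)} (he : e ∈ Hm π) :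
    cutCount (Cset π) e = 1 := by
  obtain ⟨t, -, rfl⟩ := mem_image.1 he
  exact cutCount_Cset_fEdge π _

/-! ### The key fact: `δ(U) ∩ M = H` for compatible pairs -/

/-- The vertices of a cut of `𝒰ex(T,H)` with slot in `C ∪ D` lie in `c = V(H) ∩ C`.
[cite: Rothvoss2017, §3.1 (PDF p. 8)] -/
theorem mem_cset_of_mem_Uex3 {μ : ℕ} {π : Equiv.Perm (Slot m q)} {U : Finset (Slot m q)}
    (hU : U ∈ Uex3 μ π) {v : Slot m q} (hv : v ∈ U) (hrole : role (π v) = Role.CD) :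
    v ∈ cset π := by
  simp only [Uex3, UallP, mem_filter, mem_univ, true_and] at hU
  obtain ⟨⟨-, hAC, -⟩, hcap⟩ := hU
  rcases (role_eq_CD_iff _).1 hrole with hC | hD
  · have : v ∈ U ∩ Cset π := mem_inter.2 ⟨hv, by simpa [Cset, mem_pull] using hC⟩
    rwa [hcap] at this
  · have := hAC v hv
    rw [isAC_of_mem_DSlots hD] at this
    exact absurd this (by simp)

/-- A vertex of role `A i` lies in block `A_i`. [folklore] -/
theorem mem_Ablk_of_role {π : Equiv.Perm (Slot m q)} {v : Slot m q} {i : Fin m}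
    (h : role (π v) = Role.A i) : v ∈ Ablk π i := by
  obtain ⟨x, hx⟩ := (role_eq_A_iff _ _).1 h
  simp only [Ablk, mem_pull, mem_aSlots]
  exact ⟨x, hx⟩

/-- A vertex of role `B i` is not in `A ∪ C`. [folklore] -/
theorem isAC_of_role_B {π : Equiv.Perm (Slot m q)} {v : Slot m q} {i : Fin m}
    (h : role (π v) = Role.B i) : isAC (π v) = false := by
  obtain ⟨sd, x, hx⟩ := (role_eq_B_iff _ _).1 h
  rw [hx]; rfl

/-- **Key fact (`3`-side).** For `U ∈ 𝒰ex(T,H)` and `M ∈ ℳex(T,H)`, the edges of `M` with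
exactly one endpoint in `U` are exactly the three edges of `H`: "if we take a matching
`M ∈ ℳ_all(T)` and a cut `U ∈ 𝒰_all(T)`, then the intersection `δ(U) ∩ M` can only contain
edges in `E(C ∪ D)`", and those touching `c = U ∩ C` are the `H`-edges.
[cite: Rothvoss2017, §3.1–3.2 (PDF p. 8)] -/
theorem cut_eq_H {μ : ℕ} {π : Equiv.Perm (Slot m q)} {U : Finset (Slot m q)} {M : Finset (Sym2 (Slot m q))}
    (hU : U ∈ Uex3 μ π) (hM : M ∈ Mex3 π) :
    (M.filter fun e => cutCount U e = 1) = Hm π := by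
  have hU' := hU
  simp only [Uex3, UallP, mem_filter, mem_univ, true_and] at hU'
  obtain ⟨⟨-, hAC, hblk⟩, hcap⟩ := hU'
  simp only [Mex3, MallP, mem_filter, mem_perfectMatchings] at hM
  obtain ⟨⟨hPM, hsame⟩, hH⟩ := hM
  have hHM : Hm π ⊆ M := fun e he => by
    have : e ∈ M.filter fun e => cutCount (Cset π) e = 1 := by rw [hH]; exact he
    exact (mem_filter.1 this).1
  have hcU : cset π ⊆ U := fun v hv => by
    have : v ∈ U ∩ Cset π := by rw [hcap]; exact hv
    exact (mem_inter.1 this).1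
  -- an `M`-edge leaving `U` from a `CD`-vertex of `U` is the `H`-edge at that vertex
  have key : ∀ {u v : Slot m q}, s(u, v) ∈ M → role (π u) = Role.CD → u ∈ U → v ∉ U →
      s(u, v) ∈ Hm π := by
    intro u v huv hu huU _
    have huc : u ∈ cset π := mem_cset_of_mem_Uex3 hU huU hu
    obtain ⟨f, hf, huf⟩ := (isPMOn_Hm π).exists_mem (mem_union_left _ huc)
    have := hPM.unique huv (hHM hf) (Sym2.mem_mk_left u v) huf
    rw [this]
    exact hf
  ext e
  simp only [mem_filter]
  constructor
  · rintro ⟨he, hcut⟩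
    induction e using Sym2.ind with
    | h u v =>
      have hr := (sameRole_mk π u v).1 (hsame _ he)
      rw [cutCount_mk] at hcut
      rcases hru : role (π u) with i | _ | i
      · -- block `A_i`: in or out of `U` as a whole
        exfalso
        have hu : u ∈ Ablk π i := mem_Ablk_of_role hru
        have hv : v ∈ Ablk π i := mem_Ablk_of_role (hr ▸ hru)
        rcases hblk i with hin | hout
        · simp [hin hu, hin hv] at hcut
        · simp [disjoint_left.1 hout hu, disjoint_left.1 hout hv] at hcut
      · -- block `C ∪ D`
        by_cases huU : u ∈ U
        · have hvU : v ∉ U := by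
            intro hvU; simp [huU, hvU] at hcut
          exact key he hru huU hvU
        · have hvU : v ∈ U := by
            by_contra hvU; simp [huU, hvU] at hcut
          rw [hru] at hr
          rw [Sym2.eq_swap]
          exact key (by rw [Sym2.eq_swap]; exact he) hr.symm hvU huU
      · -- block `B_i`: disjoint from `U`
        exfalso
        have hu : u ∉ U := fun huU => by
          have := hAC u huU
          rw [isAC_of_role_B hru] at this
          exact Bool.false_ne_true this
        have hv : v ∉ U := fun hvU => by
          have := hAC v hvU
          rw [isAC_of_role_B (hr ▸ hru)] at this
          exact Bool.false_ne_true this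
        simp [hu, hv] at hcut
  · intro he
    refine ⟨hHM he, ?_⟩
    obtain ⟨t, rfl⟩ := mem_Hm_iff.1 he
    rw [cutCount_mk]
    have h1 : π.symm (c t) ∈ U := hcU (by simp [cset, mem_pull])
    have h2 : π.symm (d t) ∉ U := fun h => by
      have := hAC _ h
      simp [isAC] at this
    simp [h1, h2]

end Literature.Barriers.PneNP
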